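import Literature.Probability.RandomPlanarGeometry.LoewnerReachMeasurable
import Literature.Probability.RandomPlanarGeometry.SLEDerivRatioTail
import Literature.Probability.RandomPlanarGeometry.BrownianStrongMarkov
import HarnessLib

/-!
# The strong Markov property of Rohde–Schramm's ratio at the time it reaches a level

Topic `Probability/RandomPlanarGeometry`; theorems and auxiliary definitions. For the SLE_κ flow
of a point `z ∈ ℍ` (driving function `W = √κ B` on the canonical space) and Rohde–Schramm's ratio
`ψₜ(z) = (Im z)|gₜ'(z)|/Im gₜ(z)` (*Basic properties of SLE*, Ann. of Math. 161 (2005),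
Lemma 6.3), let `H = H^n_λ` be the time at which `ψ` reaches the level `λ ≥ 1` along `[0, ρₙ]`
(`slePsiHitTime`, `SLEDerivRatioTail.lean`; `ρₙ` the localizing times of `SLEPointFlow.lean`) and
`T = H ∧ ρₙ` (`slePsiHitLocTime`). We prove the **restart inequality**

  `P[ ψ(z) reaches Λλ before T_z, H ≤ ρₙ, |w_H| > K ] ≤ p · P[ H ≤ ρₙ, |w_H| > K ]`
  (`measureReal_reach_mul_inter_le`)

whenever `P[ψ(x) reaches Λ before T_x] ≤ p` for every starting point `x ∈ ℍ` of slope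
`|Re x/Im x| > K`. Here `w_H = Re z_H/Im z_H` is the slope of the centred flow `zₜ = gₜ(z) - Wₜ`
at time `H`. Proof:

* *pathwise restart* (`mem_sleRatioReach_mul_iff_of_hit`): on `{H ≤ ρₙ}` one has `ψ_H = λ`, and
  by the cocycle of `LoewnerPointCocycle.lean` (`Loewner.exists_reach_mul_iff_incr`) the ratio
  reaches `Λλ = Λ ψ_H` before `T_z` iff the ratio of the frozen point `z_H` under the increments
  `W(H + ·) - W(H) = √κ Z^T` reaches `Λ` before its own swallowing time;
* the increments `Z^T = B_{T+·} - B_T` after the stopping time `T` are a Brownian motion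
  independent of `𝓕_T ∋ z_H, 𝟙_{H ≤ ρₙ}, w_H` (freezing formula
  `integral_brownianIncrAfter_eq_integral_integral` of `BrownianStrongMarkov.lean`, Le Gall
  (2016), Thm. 2.20), the restarted event being jointly measurable in (frozen point, path)
  (`Loewner.measurableSet_reach_scaledPath_prod`, `LoewnerReachMeasurable.lean`);
* on a Brownian path the restarted flow is the SLE_κ flow from the frozen point, whose
  probability of reaching `Λ` is at most `p` on `{|w_H| > K}`.

This is the form in which the domain Markov property of SLE (Rohde–Schramm (2005), p. 911;
Lawler (2005), §6.2) enters the one-point estimate of Beffara (2008), Prop. 4 / Lawler (2005),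
Thm. 7.9 (file `SLEOnePointSharpUpper`). Also recorded: `sleRatioReach` is an event
(`measurableSet_sleRatioReach`).

## References

* S. Rohde, O. Schramm, *Basic properties of SLE*, Ann. of Math. 161 (2005), Lemma 6.3, §7 p. 911.
* G. F. Lawler, *Conformally Invariant Processes in the Plane*, AMS (2005), §6.2, §7.4.
* J.-F. Le Gall, *Brownian Motion, Martingales, and Stochastic Calculus* (2016), Thm. 2.20.
  [Legall2016]
-/

noncomputable section

open Set Filter MeasureTheory Complex
open _root_.Topology
open scoped NNReal ENNReal

namespace Literature.Probability.RandomPlanarGeometry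

open Loewner Literature.Probability.Process

variable {κ : ℝ≥0} {z : ℂ} {n : ℕ} {lam : ℝ}

/-! ### `sleRatioReach` is an event; the SLE driving path as a scaled regularised path -/

/-- `sleRatioReach κ x Λ` is `Loewner.reach` for the family `sleDriving κ` (`rfl`). [folklore] -/
theorem sleRatioReach_eq_reach (κ : ℝ≥0) (x : ℂ) (lam : ℝ) :
    sleRatioReach κ x lam = reach (sleDriving κ) x lam := rfl

/-- **`E_Λ(x) = {∃ t < T_x, ψₜ(x) ≥ Λ}` is an event** (`Loewner.measurableSet_reach`).
[cite: RohdeSchramm2005, Lemma 6.3] -/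
theorem measurableSet_sleRatioReach (κ : ℝ≥0) {x : ℂ} (hx : 0 < x.im) (lam : ℝ) :
    MeasurableSet (sleRatioReach κ x lam) :=
  measurableSet_reach (U := sleDriving κ) (continuous_sleDriving κ) (measurable_sleDriving κ) hx lam

/-- On a Brownian path the scaled regularised path `√κ · pathRegularize` is the SLE_κ driving
function (the universal driving path `pathDriving κ` of `RadialBesselMarkov.lean`). [folklore] -/
theorem scaledPath_brownian (κ : ℝ≥0) (ω : ℝ≥0 → ℝ) :
    scaledPath (Real.sqrt κ) (fun u ↦ brownian u ω) = sleDriving κ ω := by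
  funext u
  rw [scaledPath_apply, pathRegularize_eq_of_continuous (continuous_brownian ω), sleDriving_apply]

/-- On `{T = r}` the scaled regularised path of the increments `Z^T = B_{T+·} - B_T` is the
increment process `W(r + ·) - W(r)` of the SLE_κ driving function. [folklore] -/
theorem scaledPath_brownianIncrAfter {T : (ℝ≥0 → ℝ) → WithTop ℝ≥0} {ω : ℝ≥0 → ℝ} {r : ℝ≥0}
    (hr : T ω = r) :
    scaledPath (Real.sqrt κ) (fun u ↦ brownianIncrAfter T u ω) = incrDriving (sleDriving κ ω) r := by
  funext u
  rw [scaledPath_apply, pathRegularize_eq_of_continuous (continuous_brownianIncrAfter T ω)]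
  beta_reduce
  rw [brownianIncrAfter_of_eq_coe hr, incrDriving_apply, sleDriving_apply, sleDriving_apply]
  ring

/-! ### The time `T = H^n_λ ∧ ρₙ` and the frozen data -/

variable (κ z) in
/-- **`T = H^n_λ ∧ ρₙ`**: the time at which `ψ^{ρₙ}` reaches `λ`, capped at `ρₙ` (a finite stopping
time; equal to `H^n_λ` whenever the level is reached along `[0, ρₙ]`). [folklore] -/
def slePsiHitLocTime (lam : ℝ) (n : ℕ) (ω : ℝ≥0 → ℝ) : WithTop ℝ≥0 :=
  min (slePsiHitTime κ z lam n ω) (slePointLocTime κ z n ω)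

variable (κ z) in
/-- **The event `{H^n_λ ≤ ρₙ}`**: `ψ` reaches `λ` along `[0, ρₙ]` (i.e. `H^n_λ < ∞`). [folklore] -/
def sleHitReached (lam : ℝ) (n : ℕ) : Set (ℝ≥0 → ℝ) :=
  {ω | slePsiHitTime κ z lam n ω ≠ ⊤}

variable (κ z) in
/-- `x_T` read on the `ρₙ`-stopped flow. [folklore] -/
def sleHitRe (lam : ℝ) (n : ℕ) : (ℝ≥0 → ℝ) → ℝ :=
  stoppedValue (stoppedProcess (slePointRe κ z) (slePointLocTime κ z n)) (slePsiHitLocTime κ z lam n)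

variable (κ z) in
/-- `y_T` read on the `ρₙ`-stopped flow. [folklore] -/
def sleHitIm (lam : ℝ) (n : ℕ) : (ℝ≥0 → ℝ) → ℝ :=
  stoppedValue (stoppedProcess (slePointIm κ z) (slePointLocTime κ z n)) (slePsiHitLocTime κ z lam n)

variable (κ z) in
/-- **The frozen point `z_T = x_T + i y_T`** (the centred flow at time `T`). [folklore] -/
def sleHitPoint (lam : ℝ) (n : ℕ) (ω : ℝ≥0 → ℝ) : ℂ :=
  (sleHitRe κ z lam n ω : ℂ) + (sleHitIm κ z lam n ω : ℂ) * I

variable (κ z) in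
/-- **The frozen slope `w_T = x_T / y_T`.** [folklore] -/
def sleHitSlope (lam : ℝ) (n : ℕ) (ω : ℝ≥0 → ℝ) : ℝ :=
  sleHitRe κ z lam n ω / sleHitIm κ z lam n ω

variable (κ z) in
/-- `ψ^{ρₙ}` read at time `T`. [folklore] -/
def sleHitPsi (lam : ℝ) (n : ℕ) : (ℝ≥0 → ℝ) → ℝ :=
  stoppedValue (stoppedProcess (slePointPsi κ z) (slePointLocTime κ z n)) (slePsiHitLocTime κ z lam n)

section Time

/-- `T` is a stopping time of the raw Brownian filtration. [folklore] -/
theorem isStoppingTime_slePsiHitLocTime (hz : 0 < z.im) (lam : ℝ) (n : ℕ) :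
    IsStoppingTime brownianFiltration (slePsiHitLocTime κ z lam n) :=
  (isStoppingTime_slePsiHitTime hz lam n).min (isStoppingTime_slePointLocTime κ hz n)

/-- `T ≤ ρₙ`. [folklore] -/
theorem slePsiHitLocTime_le_locTime (ω : ℝ≥0 → ℝ) :
    slePsiHitLocTime κ z lam n ω ≤ slePointLocTime κ z n ω := min_le_right _ _

/-- `T ≤ H^n_λ`. [folklore] -/
theorem slePsiHitLocTime_le_hitTime (ω : ℝ≥0 → ℝ) :
    slePsiHitLocTime κ z lam n ω ≤ slePsiHitTime κ z lam n ω := min_le_left _ _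

/-- `T < ∞`. [folklore] -/
theorem slePsiHitLocTime_ne_top (ω : ℝ≥0 → ℝ) : slePsiHitLocTime κ z lam n ω ≠ ⊤ :=
  ne_top_of_le_ne_top (slePointLocTime_ne_top n ω) (slePsiHitLocTime_le_locTime ω)

/-- `↑(T.untopA) = T` (`T` is finite). [folklore] -/
theorem coe_untopA_slePsiHitLocTime (ω : ℝ≥0 → ℝ) :
    (((slePsiHitLocTime κ z lam n ω).untopA : ℝ≥0) : WithTop ℝ≥0) = slePsiHitLocTime κ z lam n ω := by
  rw [WithTop.untopA_eq_untop (slePsiHitLocTime_ne_top ω), WithTop.coe_untop]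

/-- `↑(T.untopA) ≤ ρₙ`. [folklore] -/
theorem coe_untopA_slePsiHitLocTime_le_locTime (ω : ℝ≥0 → ℝ) :
    (((slePsiHitLocTime κ z lam n ω).untopA : ℝ≥0) : WithTop ℝ≥0) ≤ slePointLocTime κ z n ω := by
  rw [coe_untopA_slePsiHitLocTime]
  exact slePsiHitLocTime_le_locTime ω

/-- `T < T_z`. [folklore] -/
theorem coe_untopA_slePsiHitLocTime_lt (hz : 0 < z.im) (ω : ℝ≥0 → ℝ) :
    (((slePsiHitLocTime κ z lam n ω).untopA : ℝ≥0) : WithTop ℝ≥0) <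
      swallowingTime (sleDriving κ ω) z :=
  coe_lt_swallowingTime_of_le_locTime hz (n := n) (coe_untopA_slePsiHitLocTime_le_locTime ω)

/-- **If the level is reached along `[0, ρₙ]` then `H^n_λ ≤ ρₙ`** (the stopped ratio is constant
after `ρₙ`). [folklore] -/
theorem slePsiHitTime_le_locTime_of_ne_top (hz : 0 < z.im) {ω : ℝ≥0 → ℝ}
    (h : slePsiHitTime κ z lam n ω ≠ ⊤) :
    slePsiHitTime κ z lam n ω ≤ slePointLocTime κ z n ω := by
  obtain ⟨ρ, hρ⟩ := WithTop.ne_top_iff_exists.1 (slePointLocTime_ne_top (κ := κ) (z := z) n ω)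
  obtain ⟨j, hj⟩ := hittingAfter_zero_ne_top_iff.1 h
  rw [← hρ]
  refine (hittingAfter_zero_le_coe_iff isClosed_Ici (continuous_slePsiGauge hz lam n ω)).2
    ⟨min j ρ, min_le_right _ _, ?_⟩
  -- the gauge at `j ∧ ρₙ` equals the gauge at `j`
  have heq : slePsiGauge κ z lam n (min j ρ) ω = slePsiGauge κ z lam n j ω := by
    simp only [slePsiGauge, stoppedProcess_slePointPsi_eq, ← hρ, ← WithTop.coe_min, min_assoc,
      min_self]
  rw [heq]
  exact hj

/-- On `{H^n_λ ≤ ρₙ}`, `T = H^n_λ`. [folklore] -/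
theorem slePsiHitLocTime_eq_of_ne_top (hz : 0 < z.im) {ω : ℝ≥0 → ℝ}
    (h : slePsiHitTime κ z lam n ω ≠ ⊤) :
    slePsiHitLocTime κ z lam n ω = slePsiHitTime κ z lam n ω :=
  min_eq_left (slePsiHitTime_le_locTime_of_ne_top hz h)

/-- Off `{H^n_λ ≤ ρₙ}`, `T = ρₙ`. [folklore] -/
theorem slePsiHitLocTime_eq_of_eq_top {ω : ℝ≥0 → ℝ} (h : slePsiHitTime κ z lam n ω = ⊤) :
    slePsiHitLocTime κ z lam n ω = slePointLocTime κ z n ω := by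
  rw [slePsiHitLocTime, h, min_eq_right le_top]

/-- **`ψ_T ≤ λ`** (`λ ≥ 1`): `ψ^{ρₙ} < λ` strictly before `T ≤ H^n_λ`, `ψ^{ρₙ}` is continuous and
`ψ₀ = 1`. [folklore] -/
theorem derivRatio_untopA_slePsiHitLocTime_le (hz : 0 < z.im) (hlam : 1 ≤ lam) (ω : ℝ≥0 → ℝ) :
    derivRatio (sleDriving κ ω) z (slePsiHitLocTime κ z lam n ω).untopA ≤ lam := by
  set u : ℝ≥0 := (slePsiHitLocTime κ z lam n ω).untopA with hu
  have hu' : slePsiHitLocTime κ z lam n ω = u := (coe_untopA_slePsiHitLocTime ω).symm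
  set P : ℝ≥0 → ℝ := fun t ↦ stoppedProcess (slePointPsi κ z) (slePointLocTime κ z n) t ω with hP
  have hcont : Continuous P := continuous_stoppedProcess_slePointPsi hz (fun _ ↦ le_rfl) ω
  have huρ : ((u : ℝ≥0) : WithTop ℝ≥0) ≤ slePointLocTime κ z n ω := coe_untopA_slePsiHitLocTime_le_locTime ω
  have hPu : P u = derivRatio (sleDriving κ ω) z u := by
    simp only [hP, stoppedProcess_slePointPsi_eq, min_eq_left huρ]
    rfl
  rw [← hPu]
  rcases eq_or_ne u 0 with h0 | hu0
  · rw [h0]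
    simp only [hP, stoppedProcess_slePointPsi_zero hz]
    exact hlam
  · have hlt : ∀ t : ℝ≥0, t < u → P t < lam := fun t ht ↦
      stoppedProcess_slePointPsi_lt_of_lt_psiHitTime
        ((WithTop.coe_lt_coe.2 ht).trans_le (hu' ▸ slePsiHitLocTime_le_hitTime ω))
    have hmaps : MapsTo P (Iio u) (Iic lam) := fun t ht ↦ (hlt t ht).le
    have hcl : u ∈ closure (Iio u) := by
      rw [closure_Iio' (show (Iio u).Nonempty from ⟨0, pos_iff_ne_zero.2 hu0⟩)]
      exact self_mem_Iic
    have h := map_mem_closure hcont hcl hmaps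
    rwa [isClosed_Iic.closure_eq] at h

/-- **`ψ_T ≥ λ` on `{H^n_λ ≤ ρₙ}`** (the infimum defining `H^n_λ` is attained: closed level set,
continuous path). [folklore] -/
theorem le_derivRatio_untopA_slePsiHitLocTime (hz : 0 < z.im) {ω : ℝ≥0 → ℝ}
    (h : slePsiHitTime κ z lam n ω ≠ ⊤) :
    lam ≤ derivRatio (sleDriving κ ω) z (slePsiHitLocTime κ z lam n ω).untopA := by
  obtain ⟨r, hr⟩ := WithTop.ne_top_iff_exists.1 h
  have hT : slePsiHitLocTime κ z lam n ω = r := by rw [slePsiHitLocTime_eq_of_ne_top hz h, hr]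
  have hmem := mem_of_hittingAfter_zero_eq_coe isClosed_Ici (continuous_slePsiGauge hz lam n ω) hr.symm
  simp only [mem_Ici, slePsiGauge, sub_nonneg] at hmem
  have hrρ : ((r : ℝ≥0) : WithTop ℝ≥0) ≤ slePointLocTime κ z n ω := hT ▸ slePsiHitLocTime_le_locTime ω
  rw [stoppedProcess_slePointPsi_eq, min_eq_left hrρ] at hmem
  rw [hT]
  exact hmem

/-- **`ψ_T = λ` on `{H^n_λ ≤ ρₙ}`** (`λ ≥ 1`). [folklore] -/
theorem derivRatio_untopA_slePsiHitLocTime_eq (hz : 0 < z.im) (hlam : 1 ≤ lam) {ω : ℝ≥0 → ℝ}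
    (h : slePsiHitTime κ z lam n ω ≠ ⊤) :
    derivRatio (sleDriving κ ω) z (slePsiHitLocTime κ z lam n ω).untopA = lam :=
  le_antisymm (derivRatio_untopA_slePsiHitLocTime_le hz hlam ω)
    (le_derivRatio_untopA_slePsiHitLocTime hz h)

end Time

section Frozen

/-- `x_T = Re z_T` (the `ρₙ`-stopped flow read at `T ≤ ρₙ` is the flow at `T`). [folklore] -/
theorem sleHitRe_eq (ω : ℝ≥0 → ℝ) :
    sleHitRe κ z lam n ω = (centredMap (sleDriving κ ω) (slePsiHitLocTime κ z lam n ω).untopA z).re := by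
  have hle := coe_untopA_slePsiHitLocTime_le_locTime (κ := κ) (z := z) (lam := lam) (n := n) ω
  simp only [sleHitRe, stoppedValue, stoppedProcess_slePointRe_eq, min_eq_left hle]
  rfl

/-- `y_T = Im z_T`. [folklore] -/
theorem sleHitIm_eq (hz : 0 < z.im) (ω : ℝ≥0 → ℝ) :
    sleHitIm κ z lam n ω = (centredMap (sleDriving κ ω) (slePsiHitLocTime κ z lam n ω).untopA z).im := by
  have hle := coe_untopA_slePsiHitLocTime_le_locTime (κ := κ) (z := z) (lam := lam) (n := n) ω
  simp only [sleHitIm, stoppedValue]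
  rw [stoppedProcess_slePointIm_eq hz (σ := slePointLocTime κ z n) (fun _ ↦ le_rfl),
    min_eq_left hle, untopA_coe]

/-- **`z_T` is the centred flow at time `T`.** [folklore] -/
theorem sleHitPoint_eq (hz : 0 < z.im) (ω : ℝ≥0 → ℝ) :
    sleHitPoint κ z lam n ω = centredMap (sleDriving κ ω) (slePsiHitLocTime κ z lam n ω).untopA z := by
  rw [sleHitPoint, sleHitRe_eq, sleHitIm_eq hz]
  apply Complex.ext <;> simp

/-- `Im z_T > 0`. [folklore] -/
theorem sleHitPoint_im_pos (hz : 0 < z.im) (ω : ℝ≥0 → ℝ) : 0 < (sleHitPoint κ z lam n ω).im := by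
  rw [sleHitPoint_eq hz]
  exact im_centredMap_pos (continuous_sleDriving κ ω) hz (coe_untopA_slePsiHitLocTime_lt hz ω)

/-- **`w_T` is the slope of the centred flow at time `T`.** [folklore] -/
theorem sleHitSlope_eq (hz : 0 < z.im) (ω : ℝ≥0 → ℝ) :
    sleHitSlope κ z lam n ω = cotArg (sleDriving κ ω) z (slePsiHitLocTime κ z lam n ω).untopA := by
  rw [sleHitSlope, sleHitRe_eq, sleHitIm_eq hz, cotArg_apply]

/-- `w_T = Re z_T / Im z_T`. [folklore] -/
theorem sleHitSlope_eq_div (hz : 0 < z.im) (ω : ℝ≥0 → ℝ) :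
    sleHitSlope κ z lam n ω = (sleHitPoint κ z lam n ω).re / (sleHitPoint κ z lam n ω).im := by
  rw [sleHitSlope_eq hz, sleHitPoint_eq hz, cotArg_apply]

/-- `ψ^{ρₙ}_T = ψ_T`. [folklore] -/
theorem sleHitPsi_eq (ω : ℝ≥0 → ℝ) :
    sleHitPsi κ z lam n ω = derivRatio (sleDriving κ ω) z (slePsiHitLocTime κ z lam n ω).untopA := by
  have hle := coe_untopA_slePsiHitLocTime_le_locTime (κ := κ) (z := z) (lam := lam) (n := n) ω
  simp only [sleHitPsi, stoppedValue]
  rw [stoppedProcess_slePointPsi_eq, min_eq_left hle, untopA_coe]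

/-- **`{H^n_λ ≤ ρₙ} = {λ ≤ ψ^{ρₙ}_T}`** (`λ ≥ 1`): the level is reached iff the stopped ratio at
`T` is `≥ λ` (on the complement `T = ρₙ` and `ψ^{ρₙ} < λ` throughout). [folklore] -/
theorem sleHitReached_eq (hz : 0 < z.im) :
    sleHitReached κ z lam n = {ω | lam ≤ sleHitPsi κ z lam n ω} := by
  ext ω
  simp only [sleHitReached, mem_setOf_eq, sleHitPsi_eq]
  constructor
  · exact fun h ↦ le_derivRatio_untopA_slePsiHitLocTime hz h
  · intro h htop
    have hT := slePsiHitLocTime_eq_of_eq_top (κ := κ) (z := z) (lam := lam) (n := n) htop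
    obtain ⟨ρ, hρ⟩ := WithTop.ne_top_iff_exists.1 (slePointLocTime_ne_top (κ := κ) (z := z) n ω)
    have hlt : stoppedProcess (slePointPsi κ z) (slePointLocTime κ z n) ρ ω < lam :=
      stoppedProcess_slePointPsi_lt_of_lt_psiHitTime (by rw [htop]; exact WithTop.coe_lt_top ρ)
    rw [stoppedProcess_slePointPsi_eq, ← hρ, ← WithTop.coe_min, min_self] at hlt
    rw [hT, ← hρ] at h
    exact absurd (lt_of_lt_of_le hlt h) (lt_irrefl _)

end Frozen

/-! ### `𝓕_T`-measurability of the frozen data -/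

section Measurable

/-- `x_T` is `𝓕_T`-measurable. [folklore] -/
theorem measurable_sleHitRe (hz : 0 < z.im) (lam : ℝ) (n : ℕ) :
    Measurable[(isStoppingTime_slePsiHitLocTime (κ := κ) hz lam n).measurableSpace]
      (sleHitRe κ z lam n) :=
  measurable_stoppedValue
    (isStronglyProgressive_stoppedProcess_slePointRe hz (isStoppingTime_slePointLocTime κ hz n))
    (isStoppingTime_slePsiHitLocTime hz lam n)

/-- `y_T` is `𝓕_T`-measurable. [folklore] -/
theorem measurable_sleHitIm (hz : 0 < z.im) (lam : ℝ) (n : ℕ) :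
    Measurable[(isStoppingTime_slePsiHitLocTime (κ := κ) hz lam n).measurableSpace]
      (sleHitIm κ z lam n) :=
  measurable_stoppedValue
    (isStronglyProgressive_stoppedProcess_slePointIm (κ := κ) hz (isStoppingTime_slePointLocTime κ hz n))
    (isStoppingTime_slePsiHitLocTime hz lam n)

/-- `ψ^{ρₙ}_T` is `𝓕_T`-measurable. [folklore] -/
theorem measurable_sleHitPsi (hz : 0 < z.im) (lam : ℝ) (n : ℕ) :
    Measurable[(isStoppingTime_slePsiHitLocTime (κ := κ) hz lam n).measurableSpace]
      (sleHitPsi κ z lam n) :=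
  measurable_stoppedValue
    (isStronglyProgressive_stoppedProcess_slePointPsi hz (isStoppingTime_slePointLocTime κ hz n)
      (fun _ ↦ le_rfl))
    (isStoppingTime_slePsiHitLocTime hz lam n)

/-- **`z_T` is `𝓕_T`-measurable.** [folklore] -/
theorem measurable_sleHitPoint (hz : 0 < z.im) (lam : ℝ) (n : ℕ) :
    Measurable[(isStoppingTime_slePsiHitLocTime (κ := κ) hz lam n).measurableSpace]
      (sleHitPoint κ z lam n) :=
  (Complex.measurable_ofReal.comp (measurable_sleHitRe hz lam n)).add
    ((Complex.measurable_ofReal.comp (measurable_sleHitIm hz lam n)).mul_const I)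

/-- **`w_T` is `𝓕_T`-measurable.** [folklore] -/
theorem measurable_sleHitSlope (hz : 0 < z.im) (lam : ℝ) (n : ℕ) :
    Measurable[(isStoppingTime_slePsiHitLocTime (κ := κ) hz lam n).measurableSpace]
      (sleHitSlope κ z lam n) :=
  (measurable_sleHitRe hz lam n).div (measurable_sleHitIm hz lam n)

/-- **`{H^n_λ ≤ ρₙ} ∈ 𝓕_T`.** [folklore] -/
theorem measurableSet_sleHitReached (hz : 0 < z.im) (lam : ℝ) (n : ℕ) :
    MeasurableSet[(isStoppingTime_slePsiHitLocTime (κ := κ) hz lam n).measurableSpace]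
      (sleHitReached κ z lam n) := by
  rw [sleHitReached_eq hz]
  exact measurableSet_le measurable_const (measurable_sleHitPsi hz lam n)

/-- **`{H^n_λ ≤ ρₙ, |w_T| > K} ∈ 𝓕_T`.** [folklore] -/
theorem measurableSet_sleHitReached_inter (hz : 0 < z.im) (lam : ℝ) (n : ℕ) (K : ℝ) :
    MeasurableSet[(isStoppingTime_slePsiHitLocTime (κ := κ) hz lam n).measurableSpace]
      (sleHitReached κ z lam n ∩ {ω | K < |sleHitSlope κ z lam n ω|}) :=
  (measurableSet_sleHitReached hz lam n).inter
    (measurableSet_lt measurable_const (continuous_abs.measurable.comp (measurable_sleHitSlope hz lam n)))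

/-- The same event is measurable. [folklore] -/
theorem measurableSet_sleHitReached_inter' (hz : 0 < z.im) (lam : ℝ) (n : ℕ) (K : ℝ) :
    MeasurableSet (sleHitReached κ z lam n ∩ {ω | K < |sleHitSlope κ z lam n ω|}) :=
  (isStoppingTime_slePsiHitLocTime (κ := κ) hz lam n).measurableSpace_le _
    (measurableSet_sleHitReached_inter hz lam n K)

/-- `{H^n_λ ≤ ρₙ}` is measurable. [folklore] -/
theorem measurableSet_sleHitReached' (hz : 0 < z.im) (lam : ℝ) (n : ℕ) :
    MeasurableSet (sleHitReached κ z lam n) :=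
  (isStoppingTime_slePsiHitLocTime (κ := κ) hz lam n).measurableSpace_le _
    (measurableSet_sleHitReached hz lam n)

end Measurable

/-! ### The pathwise restart identity -/

section Restart

variable (κ) in
/-- **The restarted event** as a set of pairs (starting point, raw path): `Im x > 0` and the ratio
of `x` under the driving function `√κ · pathRegularize w` reaches `Λ` before `T_x`
(measurable, `Loewner.measurableSet_reach_scaledPath_prod`). [folklore] -/
def sleRestartReach (Λ : ℝ) : Set (ℂ × (ℝ≥0 → ℝ)) :=
  {p | 0 < p.1.im ∧ ∃ t : ℝ≥0, (t : WithTop ℝ≥0) < swallowingTime (scaledPath (Real.sqrt κ) p.2) p.1 ∧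
    Λ ≤ derivRatio (scaledPath (Real.sqrt κ) p.2) p.1 t}

/-- The restarted event is measurable in `ℂ × (ℝ≥0 → ℝ)`. [folklore] -/
theorem measurableSet_sleRestartReach (κ : ℝ≥0) (Λ : ℝ) : MeasurableSet (sleRestartReach κ Λ) :=
  measurableSet_reach_scaledPath_prod _ _

/-- **On a Brownian path the restarted event is the SLE_κ event from the frozen point**:
`(x, B(ω')) ∈ sleRestartReach κ Λ ↔ ω' ∈ E_Λ(x)` for `Im x > 0`. [folklore] -/
theorem mk_brownian_mem_sleRestartReach_iff {x : ℂ} (hx : 0 < x.im) {Λ : ℝ} (ω' : ℝ≥0 → ℝ) :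
    (x, fun u ↦ brownian u ω') ∈ sleRestartReach κ Λ ↔ ω' ∈ sleRatioReach κ x Λ := by
  simp only [sleRestartReach, mem_setOf_eq, scaledPath_brownian, sleRatioReach]
  exact ⟨fun h ↦ h.2, fun h ↦ ⟨hx, h⟩⟩

/-- **Pathwise restart identity.** On `{H^n_λ ≤ ρₙ}` (`λ ≥ 1`): `ψ(z)` reaches `Λλ` before `T_z`
iff the frozen point `z_T`, driven by the increments `Z^T = B_{T+·} - B_T` (scaled and
regularised), has its ratio reach `Λ` before its swallowing time (`ψ_T = λ` and the cocycle
`Loewner.exists_reach_mul_iff_incr`). [cite: RohdeSchramm2005, Lemma 6.3] -/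
theorem mem_sleRatioReach_mul_iff_of_hit (hz : 0 < z.im) (hlam : 1 ≤ lam) {Λ : ℝ} {ω : ℝ≥0 → ℝ}
    (h : slePsiHitTime κ z lam n ω ≠ ⊤) :
    ω ∈ sleRatioReach κ z (Λ * lam) ↔
      (sleHitPoint κ z lam n ω, fun u ↦ brownianIncrAfter (slePsiHitLocTime κ z lam n) u ω) ∈
        sleRestartReach κ Λ := by
  have hW := continuous_sleDriving κ ω
  set r : ℝ≥0 := (slePsiHitLocTime κ z lam n ω).untopA with hr
  have hr' : slePsiHitLocTime κ z lam n ω = r := (coe_untopA_slePsiHitLocTime ω).symm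
  have hrτ : ((r : ℝ≥0) : WithTop ℝ≥0) < swallowingTime (sleDriving κ ω) z :=
    coe_untopA_slePsiHitLocTime_lt hz ω
  have hψ : derivRatio (sleDriving κ ω) z r = lam := derivRatio_untopA_slePsiHitLocTime_eq hz hlam h
  rw [sleRestartReach, mem_setOf_eq, scaledPath_brownianIncrAfter hr', sleHitPoint_eq hz, ← hr]
  simp only [sleRatioReach, mem_setOf_eq]
  rw [← hψ, exists_reach_mul_iff_incr hW hz hrτ Λ]
  exact ⟨fun h' ↦ ⟨im_centredMap_pos hW hz hrτ, h'⟩, fun h' ↦ h'.2⟩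

end Restart

/-! ### The restart inequality -/

section Markov

/-- **Strong Markov property of Rohde–Schramm's ratio at the time it reaches a level (restart
inequality).** Let `0 < κ`, `z ∈ ℍ`, `λ ≥ 1`, and suppose `P[E_Λ(x)] ≤ p` for every `x ∈ ℍ` with
`|Re x/Im x| > K`, where `E_Λ(x) = {ψ(x) reaches Λ before T_x}`. Then for every `n`,
`P[E_{Λλ}(z), H^n_λ ≤ ρₙ, |w_T| > K] ≤ p · P[H^n_λ ≤ ρₙ, |w_T| > K]`: conditionally on `𝓕_T`, on
`{H^n_λ ≤ ρₙ}` the event `E_{Λλ}(z)` is the event `E_Λ(z_T)` of an independent SLE_κ started from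
the frozen point `z_T` (pathwise restart identity, freezing formula at the stopping time `T`,
Le Gall (2016), Thm. 2.20). Rohde–Schramm (2005), p. 911; Lawler (2005), §6.2.
[cite: RohdeSchramm2005, Lemma 6.3] -/
theorem measureReal_reach_mul_inter_le (hz : 0 < z.im) (hlam : 1 ≤ lam) {Λ K p : ℝ}
    (hp : ∀ x : ℂ, 0 < x.im → K < |x.re / x.im| → preWienerMeasure.real (sleRatioReach κ x Λ) ≤ p)
    (n : ℕ) :
    preWienerMeasure.real (sleRatioReach κ z (Λ * lam) ∩
        (sleHitReached κ z lam n ∩ {ω | K < |sleHitSlope κ z lam n ω|})) ≤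
      p * preWienerMeasure.real (sleHitReached κ z lam n ∩ {ω | K < |sleHitSlope κ z lam n ω|}) := by
  haveI := isProbabilityMeasure_preWienerMeasure'
  set T := slePsiHitLocTime κ z lam n with hTdef
  have hT : IsStoppingTime brownianFiltration T := isStoppingTime_slePsiHitLocTime hz lam n
  have hfin : ∀ᵐ ω ∂preWienerMeasure, T ω ≠ ⊤ := ae_of_all _ fun ω ↦ slePsiHitLocTime_ne_top ω
  set A : Set (ℝ≥0 → ℝ) := sleHitReached κ z lam n ∩ {ω | K < |sleHitSlope κ z lam n ω|} with hAdef
  have hA : MeasurableSet[hT.measurableSpace] A := measurableSet_sleHitReached_inter hz lam n K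
  have hAm : MeasurableSet A := measurableSet_sleHitReached_inter' hz lam n K
  have hEm : MeasurableSet (sleRatioReach κ z (Λ * lam)) := measurableSet_sleRatioReach κ hz _
  -- frozen data and the restarted functional
  set X : (ℝ≥0 → ℝ) → ℝ × ℂ := fun ω ↦ (A.indicator 1 ω, sleHitPoint κ z lam n ω) with hXdef
  have hX : Measurable[hT.measurableSpace] X :=
    (measurable_const.indicator hA).prodMk (measurable_sleHitPoint hz lam n)
  set S : Set (ℂ × (ℝ≥0 → ℝ)) := sleRestartReach κ Λ with hSdef
  have hS : MeasurableSet S := measurableSet_sleRestartReach κ Λ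
  set G : ℝ × ℂ → (ℝ≥0 → ℝ) → ℝ := fun ax w ↦ max 0 (min 1 ax.1) * S.indicator 1 (ax.2, w) with hGdef
  have hGm : Measurable (Function.uncurry G) :=
    ((measurable_const.max (measurable_const.min measurable_fst.fst)).mul
      ((measurable_const.indicator hS).comp (measurable_fst.snd.prodMk measurable_snd)))
  have hind1 : ∀ q : ℂ × (ℝ≥0 → ℝ), S.indicator (1 : ℂ × (ℝ≥0 → ℝ) → ℝ) q ∈ Icc (0 : ℝ) 1 := fun q ↦ by
    by_cases hq : q ∈ S
    · rw [indicator_of_mem hq]; exact ⟨zero_le_one, le_rfl⟩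
    · rw [indicator_of_notMem hq]; exact ⟨le_rfl, zero_le_one⟩
  have hGb : ∀ ax w, |G ax w| ≤ 1 := fun ax w ↦ by
    have h1 : 0 ≤ max 0 (min 1 ax.1) := le_max_left _ _
    have h2 : max 0 (min 1 ax.1) ≤ 1 := max_le zero_le_one (min_le_left _ _)
    have h3 := hind1 (ax.2, w)
    rw [abs_le]
    constructor
    · nlinarith [h3.1]
    · nlinarith [h3.1, h3.2]
  -- pointwise: `𝟙_{E ∩ A} = G(X, Z^T)`
  have hptw : ∀ ω, (sleRatioReach κ z (Λ * lam) ∩ A).indicator (1 : (ℝ≥0 → ℝ) → ℝ) ω =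
      G (X ω) (fun u ↦ brownianIncrAfter T u ω) := by
    intro ω
    by_cases hωA : ω ∈ A
    · have hX1 : A.indicator (1 : (ℝ≥0 → ℝ) → ℝ) ω = 1 := indicator_of_mem hωA _
      have hiff := mem_sleRatioReach_mul_iff_of_hit (κ := κ) hz hlam (Λ := Λ) (n := n) (ω := ω) hωA.1
      rw [← hSdef, ← hTdef] at hiff
      simp only [hGdef, hXdef, hX1, min_self, max_eq_right zero_le_one, one_mul]
      by_cases hE : ω ∈ sleRatioReach κ z (Λ * lam)
      · rw [indicator_of_mem (mem_inter hE hωA), indicator_of_mem (hiff.1 hE)]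
        rfl
      · rw [indicator_of_notMem (fun h : ω ∈ sleRatioReach κ z (Λ * lam) ∩ A ↦ hE h.1),
          indicator_of_notMem (fun h ↦ hE (hiff.2 h))]
    · have hX0 : A.indicator (1 : (ℝ≥0 → ℝ) → ℝ) ω = 0 := indicator_of_notMem hωA _
      simp only [hGdef, hXdef, hX0, min_eq_right zero_le_one, max_self, zero_mul]
      exact indicator_of_notMem (fun h ↦ hωA h.2) _
  -- the inner integral on a Brownian path: `𝟙_A(ω) P[E_Λ(z_T(ω))] ≤ p 𝟙_A(ω)`
  have hinner : ∀ ω, ∫ ω', G (X ω) (fun u ↦ brownian u ω') ∂preWienerMeasure ≤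
      p * A.indicator (1 : (ℝ≥0 → ℝ) → ℝ) ω := by
    intro ω
    by_cases hωA : ω ∈ A
    · have hX1 : A.indicator (1 : (ℝ≥0 → ℝ) → ℝ) ω = 1 := indicator_of_mem hωA _
      have hx : 0 < (sleHitPoint κ z lam n ω).im := sleHitPoint_im_pos hz ω
      have hslope : K < |(sleHitPoint κ z lam n ω).re / (sleHitPoint κ z lam n ω).im| := by
        rw [← sleHitSlope_eq_div hz]; exact hωA.2
      have heq : ∀ ω', G (X ω) (fun u ↦ brownian u ω') =
          (sleRatioReach κ (sleHitPoint κ z lam n ω) Λ).indicator (1 : (ℝ≥0 → ℝ) → ℝ) ω' := by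
        intro ω'
        have hmem := mk_brownian_mem_sleRestartReach_iff (κ := κ) hx (Λ := Λ) ω'
        rw [← hSdef] at hmem
        simp only [hGdef, hXdef, hX1, min_self, max_eq_right zero_le_one, one_mul]
        by_cases hω' : ω' ∈ sleRatioReach κ (sleHitPoint κ z lam n ω) Λ
        · rw [indicator_of_mem hω', indicator_of_mem (hmem.2 hω')]
          rfl
        · rw [indicator_of_notMem hω', indicator_of_notMem (fun h ↦ hω' (hmem.1 h))]
      simp_rw [heq]
      rw [integral_indicator_one (measurableSet_sleRatioReach κ hx Λ), hX1, mul_one]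
      exact hp _ hx hslope
    · have hX0 : A.indicator (1 : (ℝ≥0 → ℝ) → ℝ) ω = 0 := indicator_of_notMem hωA _
      simp only [hGdef, hXdef, hX0, min_eq_right zero_le_one, max_self, zero_mul, integral_zero,
        mul_zero]
      exact le_rfl
  have hinner0 : ∀ ω, 0 ≤ ∫ ω', G (X ω) (fun u ↦ brownian u ω') ∂preWienerMeasure := fun ω ↦
    integral_nonneg fun ω' ↦ mul_nonneg (le_max_left _ _) (hind1 _).1
  -- freezing formula at `T`
  have hfreeze := integral_brownianIncrAfter_eq_integral_integral hT hfin hX hGm hGb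
  calc preWienerMeasure.real (sleRatioReach κ z (Λ * lam) ∩ A)
      = ∫ ω, (sleRatioReach κ z (Λ * lam) ∩ A).indicator (1 : (ℝ≥0 → ℝ) → ℝ) ω ∂preWienerMeasure :=
        (integral_indicator_one (hEm.inter hAm)).symm
    _ = ∫ ω, G (X ω) (fun u ↦ brownianIncrAfter T u ω) ∂preWienerMeasure :=
        integral_congr_ae (Eventually.of_forall hptw)
    _ = ∫ ω, (∫ ω', G (X ω) (fun u ↦ brownian u ω') ∂preWienerMeasure) ∂preWienerMeasure := hfreeze
    _ ≤ ∫ ω, p * A.indicator (1 : (ℝ≥0 → ℝ) → ℝ) ω ∂preWienerMeasure :=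
        integral_mono_of_nonneg (Eventually.of_forall hinner0)
          (((integrable_const 1).indicator hAm).const_mul p) (Eventually.of_forall hinner)
    _ = p * preWienerMeasure.real A := by
        rw [integral_const_mul, integral_indicator_one hAm]

end Markov

end Literature.Probability.RandomPlanarGeometry
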